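import Literature.NumberTheory.EllipticCurves.Kobayashi2003.SignedKatoDivisibility
import Literature.NumberTheory.EllipticCurves.Rank1Residual.PrintShapeTorsion
import Literature.NumberTheory.EllipticCurves.HeegnerPoints
import Literature.NumberTheory.EllipticCurves.QuadraticTwist
import HarnessLib

/-!
# Burungale–Skinner–Tian–Wan (arXiv:2409.01350v2, PREPRINT), §11.3.1 Prop. 11.11 for an elliptic
# curve at a SUPERSINGULAR prime `a_p = 0`: "Kato's main conj. [≡ Kobayashi's signed statement,
# Lemma 9.16 (ii)] for `E` and for `E ⊗ χ_L` ⟹ the `p`-part of BSD in analytic rank one" — ONE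
# explicitly labelled OPEN binder (claim-tagged; NEVER a fact), with the two main-conj. hypotheses
# spelled in the tree's Néron-normalised SIGNED cyclotomic currency (`Kobayashi2003`)

Written by the typer seat `bsd-littype-01` (gen 3) of the cross-ladder literature-typing layer
(D-0088(4); cell `run/shared/lean/pub/bsd-littype/`). Companion of the ORDINARY-branch file
`CyclotomicMainStatementRankOneBSDOPEN.lean` (gen 2, p464403: `prop1111_pPart_rankOne_of_mainStatements_ordinary_OPEN`,
predicate `CharIdealEqPadicLFunctionNeron W p`), same § of the source (D-0064; split only for the
400-line cap), same binders, same conclusion, same bridges. HONEST FRAMING: UNREFEREED preprint ⇒ an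
explicitly labelled OPEN hypothesis only (`def … : Prop`, `[claim: …, status: under-review]`), NEVER a
theorem, NEVER a `[cite:]`-fact; nothing asserted about any curve; nothing booked; no `_holds`. ONE
predicate WITH BODY (`SignedCharIdealEqPadicLFunctionNeron W p ε`, a definition; asserts nothing; its
universal closure is NOT stated), ONE OPEN binder, and bookkeeping theorems taking the binder as an
explicit hypothesis.

## The printed statement (arXiv:2409.01350v2, pp. 94–95; TeX label `p-BSD-prop`, tex l.7958)

> **Proposition 11.11.** Let `g ∈ S₂(Γ₀(N))` be an elliptic newform, `F` the Hecke field with degree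
> `d` and `𝒪` the integer ring. Let `A_g` be an associated `GL₂`-type abelian variety over `ℚ` with
> `𝒪 ↪ End(A_g)`. Let `p ∤ 2N` be a prime, `λ` a prime of the Hecke field `F` above `p` and `T` the
> `λ`-adic Tate module of `A_g`. Suppose that • `ord_{s=1} L(s,g) = 1`, • Either `λ ∤ a_p(g)` or
> `a_p(g) = 0`, • The `λ`-adic Galois representation `ρ : G_ℚ → Aut_{𝒪_λ} T` satisfies (van_ℚ).
> Let `L` be an imaginary quadratic field satisfying (ord), (coprime), (Heeg) and (van_L) so that
> `ord_{s=1} L(s, g/L) = 1`. Then the `λ`-adic Kato's main Conj[.] 9.6 for `g` and the quadratic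
> twist `g' = g ⊗ χ_L` imply the `λ`-part of the Birch and Swinnerton-Dyer conj[.] for `A_g`, that
> is, `rank_ℤ A_g(ℚ) = d`, `Ш(A_g)[λ^∞]` is finite and
> `|L^{(d)}(1,A_g)/(d!·Ω_{A_g} R(A_g))|_λ^{-1} = |#Ш(A_g)[λ^∞] · ∏_{ℓ∣N} c_ℓ(A_g)|_λ^{-1}`.

(ord) = (2.15) "`p` splits in `L`"; (coprime) = (9.9) "`(D_L, N) = 1`"; (Heeg) "`ℓ ∣ N ⟹ ℓ` splits
in `L`"; (van_M) "`T̄^{G_M} = 0`" (§2.2.2). The binders common to both branches (`W` globally minimal,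
`N = W.conductorNorm ℤ`, `p ≠ 2` good, `W.analyticRank = 1`, (van_ℚ) = `p ∤ #E(ℚ)_tors`, `K`
imaginary quadratic with `p` split, `(d_K, N) = 1`, Heegner hypothesis, `LDerivEK W K ≠ 0`, the twist
`W'` with `C • W' = W.quadraticTwist d_K` and (van_L) = `p ∤ #E(ℚ)_tors ∧ p ∤ #E^{(d_K)}(ℚ)_tors`,
the conclusion `rank = 1 ∧ Ш[p^∞]` finite `∧` no-torsion print shape) are transcribed exactly as in
the ordinary companion file, whose module docstring has the dictionary.

## Transcription, SUPERSINGULAR branch `a_p = 0` (gen 3; same binders, signed currency)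

The printed Prop. 11.11 is ONE statement with the disjunctive hypothesis "Either `λ ∤ a_p(g)` or
`a_p(g) = 0`"; its Iwasawa-theoretic hypothesis is Kato's statement 9.6 for `g` and `g'` in BOTH cases.
At a prime `p ∤ 2N` with `a_p(g) = 0`, Lemma 9.16 (ii) (p. 82: "For a prime `p ∤ 2N` of supersingular
reduction, the assertions as in part (i) hold for [statements] 9.4 and 9.6") makes 9.6 EQUIVALENT,
divisibility by divisibility, to Kobayashi's signed statement 9.4 (label `KatopLss`, p. 80): "Let
`g ∈ S₂(Γ₀(N))` be an elliptic newform, `p ∤ 2N` a prime of supersingular reduction and `∘ ∈ {+, −}`.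
(a) `X_∘(g)` is `Λ_{𝒪_λ}`-torsion. (b) For `γ = γ_g` as in Lemma 2.5, we have an equality of ideals
`(𝓛^∘_γ(g)) = ξ(X_∘(g))` in `Λ_{𝒪_λ}`" (Rem. 9.5: "Kobayashi's original formulation concerns
supersingular elliptic curves", i.e. Kobayashi, Invent. Math. 152 (2003), Main Conj., p. 2:
"`Char(Sel^±(E/F_∞)^∨) = (L_p^±(E, X))`", which the tree carries as the objects
`Kobayashi2003.SignedSelmerDualData W κ γ ε` (Def. 1.1, the dual `X^ε(E/ℚ_∞)` with `T = γ − 1`) and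
`Kobayashi2003.IsSignedPAdicLFunction f p ε L` (Pollack's `L_p^ε(E, X)` in Kobayashi's labelling,
characterised by the Mazur–Tate congruences, `Ω⁺_f`-normalised; unique, and it EXISTS for `p` odd,
good reduction, `a_p = 0` — tree fact `pollack_exists_plusMinusPAdicLFunction`, Pollack 2003 Thm. 5.6)).
So the hypothesis is spelled by ONE predicate WITH BODY,
`SignedCharIdealEqPadicLFunctionNeron W p ε` (a definition: for the cyclotomic `κ`, `γ` matching the
cyclotomic variable, the newform `f` of level `N_E`, the rational `ϖ` with `ϖ·Ω_E = Ω⁺_f`, every `L`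
with `IsSignedPAdicLFunction f p ε L` and every datum `D` of `Sel^ε(E/ℚ_∞)`: `D.X` is `Λ`-torsion and
`char_Λ X^ε = (g)` with `ι g = ϖ · ι L` — the SAME Néron normalisation `ϖ` as the ordinary companion's
`CharIdealEqPadicLFunctionNeron` and as the Summits-side typed input `KobayashiMainConj… W p ε` of `Supersingular/KobayashiMainConj….lean`,
which quantifies over Pollack PAIRS (`IsPollackPair`, a Summits-side definition) where this file
quantifies over Kobayashi's `L_p^ε` via the Literature predicate `IsSignedPAdicLFunction`; the Summits
bridge is the two-line dictionary `IsPollackPair f p L⁺ L⁻ ↔ (IsSigned… 1 L⁻ ∧ IsSigned… (−1) L⁺ ∧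
L^± ≠ 0)`, not restated here), and the OPEN binder
`prop1111_pPart_rankOne_of_signedMainStatements_supersingular_OPEN` asks it for BOTH signs `ε`, for
`W` and for the twist `W'` (READING FLAG `BSTW-1111-ss-bothsigns`: statement 9.4 is printed "for
`∘ ∈ {+, −}`"; Kobayashi's Thm. 7.4 / Lemma 9.16 (ii) make each sign separately equivalent to 9.6, so
asking both signs is a WEAKER binder than print, never stronger; the sign labelling (Kobayashi vs
Pollack, `IsSignedPAdicLFunction` docstring) is therefore immaterial here). `a_p(E) = 0` is
`W.frobeniusTrace p = 0` (hypothesis (h4) = (1.7) of the source; automatic for `p ≥ 5` supersingular);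
`E^{(d_K)}` has `a_p(E^{(d_K)}) = χ_{d_K}(p) a_p(E) = 0` and good reduction at `p ∤ d_K` (not needed
syntactically: the binder just asks the predicate for `W'`). (van_ℚ), (van_L) are kept verbatim
(`p ∤ #E(ℚ)_tors`, `p ∤ #E^{(d_K)}(ℚ)_tors`; automatic at a supersingular `p > 2`, where `E[p]` is
irreducible, but printed). READING FLAG `BSTW-1111-lattice` applies verbatim (optimal periods `γ_g` vs
the Néron period of the given `W`; at a supersingular `p ∤ 2N` the optimal lattice is unique up to
prime-to-`p` isogeny and `p ∤` Manin constant, Mazur 1978 / Abbes–Ullmo 1996, so the two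
normalisations differ by a `p`-adic unit — published, not restated). Conclusion identical to the
ordinary companion's binder. CONSUMER: the rank-one residue at a good SUPERSINGULAR prime of a curve that is NOT
semistable and NOT a prime-to-`Np` quadratic twist of a semistable curve (classes X7 ∧ r1 / X8 ∧ r1 of
`Rank1Residual/Supersingular/`, whose upper half today is Sprung 2024 Cor. 1.3 (ii) and whose full
`p`-part has no printed source): granted this PRE binder it READS "Kobayashi's signed main conj. for
`E` and for `E^{(d_L)}`" — height-free (no Kobayashi 2013 `p`-adic Gross–Zagier, no (sur)), the
supersingular twin of the ordinary K6 door of the companion file. For semistable `E` the tree already has the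
unconditional-modulo-PRE forms (`thm15_pPart_OPEN`, `cor102_twist_pPart_OPEN`, Thm. 11.12).


WEAKER-OR-EQUAL to print in every binder, modulo the reading flags above; never stronger. WHAT IS NOT
CLAIMED: nothing at `p = 2`, at `p ∣ N`, at a supersingular `p` with `a_p ≠ 0` (`p = 3`, `a_3 = ±3`),
at an ordinary `p` (companion file); no main conj. is asserted; no `_holds`.

## References
* [BurungaleSkinnerTianWan2024] arXiv:2409.01350v2: Prop. 11.11 (pp. 94–95; label p-BSD-prop, tex
  l.7958), Lemma 9.16 (p. 82; label KatoEq), statements 9.4 / 9.6 (pp. 80–81; labels KatopLss / Kato),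
  Rem. 9.5, Rem. 2.3 (label EC-optperiod-rmk), Lemma 2.5 (label GorPer), (1.7) = (h4), (2.15) = (ord),
  (9.9) = (coprime), (Heeg).
* [Kobayashi2003] Invent. Math. 152 (2003): Main Conj. (p. 2), Def. 1.1 / Thm. 1.2 (p. 2), Thm. 3.2
  and (3.4)–(3.6) (p. 7), Thm. 4.1 (p. 8), Thm. 7.4 — tree `Kobayashi2003/SignedSelmer.lean`,
  `Kobayashi2003/SignedKatoDivisibility.lean` (`SignedSelmerDualData`, `IsSignedPAdicLFunction`,
  `thm41_signedCharIdeal_divisibility`). [Pollack2003] Thm. 5.6, Prop. 6.18 (`pollack_exists_plusMinusPAdicLFunction`).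
* [Miller2011LMS] Def. 1.1 (`BSDp`); [Darmon2004] Thm. 3.22 (GZK, `rank_eq_analyticRank_of_analyticRank_le_one`).
-/

noncomputable section

open scoped Classical MatrixGroups ModularForm

open CongruenceSubgroup WeierstrassCurve Literature.NumberTheory.EllipticCurves
  Literature.NumberTheory.EllipticCurves.ModularForms
  Literature.NumberTheory.EllipticCurves.Rank1Residual NumberField

namespace Literature.NumberTheory.EllipticCurves.BurungaleSkinnerTianWan2024

open Literature.NumberTheory.EllipticCurves.Kobayashi2003

/-- **Kobayashi's signed cyclotomic statement for the triple `(E, p, ε)`, Néron normalisation** — a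
PREDICATE on `(W, p, ε)` (definition with body; nothing asserted, no universal closure stated): for the
cyclotomic `ℤ_p`-extension `κ` with a topological generator `γ` matching the cyclotomic variable of the
Mazur–Tate elements (`IsCyclotomicVariable`), the newform `f` of `E` at level `N_E`, the rational `ϖ`
with `ϖ · Ω_E = Ω⁺_f`, every `L ∈ Λ` which is Pollack's `L_p^ε(E, X)` in Kobayashi's labelling
(`Kobayashi2003.IsSignedPAdicLFunction f p ε L`; unique, and existing for `p` odd of good reduction with
`a_p = 0` by the tree fact `pollack_exists_plusMinusPAdicLFunction`) and every Pontryagin-dual datum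
`D` of `Sel^ε(E/ℚ_∞)` (`Kobayashi2003.SignedSelmerDualData W κ γ ε`, Def. 1.1; inhabited by
`nonempty_signedSelmerDualData`): `X^ε = D.X` is `Λ`-torsion and `char_Λ X^ε = (g)` with
`ι g = ϖ · ι L` in `ℚ_p⟦T⟧` — "`Char(Sel^±(E/F_∞)^∨) = (L_p^±(E, X))`" (Kobayashi 2003, p. 2) = BSTW's
statement 9.4 (b) (label KatopLss, p. 80) "`(𝓛^∘_γ(g)) = ξ(X_∘(g))` in `Λ_{𝒪_λ}`" for `g = f_E`,
`γ = ` Néron periods (Rem. 2.3). Same `ϖ` and same quantifier shape as the Summits-side typed input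
`KobayashiMainConj… W p ε` of `Rank1Residual/Supersingular/KobayashiMainConj….lean`, which quantifies
over Pollack pairs instead of `IsSignedPAdicLFunction` (module docstring). The sign labelling of
`IsSignedPAdicLFunction` (Kobayashi's, opposite to Pollack's) is inherited verbatim.
[cite: Kobayashi2003, Main Conj. (p. 2) with Def. 1.1, Thm. 3.2 and (3.4)–(3.6) (p. 7) (shape only; nothing asserted)]
[cite: BurungaleSkinnerTianWan2024, statement 9.4 (b) (p. 80; label KatopLss) with Rem. 2.3 and Rem. 9.5 (shape only; nothing asserted)] -/
def SignedCharIdealEqPadicLFunctionNeron (W : WeierstrassCurve ℚ) [W.IsElliptic]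
    [W.IsGloballyMinimal] (p : ℕ) [Fact p.Prime] (ε : ℤˣ) : Prop :=
  ∀ (κ : ZpExtension ℚ p) (γ : Field.absoluteGaloisGroup ℚ),
      κ.IsCyclotomic → κ.IsTopGenerator γ → IsCyclotomicVariable p γ →
    ∀ [NeZero (W.conductorNorm ℤ)] (f : CuspForm (Gamma0 (W.conductorNorm ℤ)) 2),
      IsNewformOf W f → ∀ (ϖ : ℚ), (ϖ : ℝ) * W.realPeriodRat = plusPeriod f →
    ∀ (L : IwasawaAlgebra p), IsSignedPAdicLFunction f p ε L →
    ∀ (D : SignedSelmerDualData W κ γ ε), Module.IsTorsion (IwasawaAlgebra p) D.X ∧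
      ∃ g : IwasawaAlgebra p, D.charIdeal = Ideal.span {g} ∧
        iwasawaToPowerSeries p g = PowerSeries.C (ϖ : ℚ_[p]) * iwasawaToPowerSeries p L

/-- Unfolding lemma for `SignedCharIdealEqPadicLFunctionNeron` (definitional).
[cite: Kobayashi2003, Main Conj. (p. 2) (shape only)] -/
theorem signedCharIdealEqPadicLFunctionNeron_iff (W : WeierstrassCurve ℚ) [W.IsElliptic]
    [W.IsGloballyMinimal] (p : ℕ) [Fact p.Prime] (ε : ℤˣ) :
    SignedCharIdealEqPadicLFunctionNeron W p ε ↔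
      ∀ (κ : ZpExtension ℚ p) (γ : Field.absoluteGaloisGroup ℚ),
          κ.IsCyclotomic → κ.IsTopGenerator γ → IsCyclotomicVariable p γ →
        ∀ [NeZero (W.conductorNorm ℤ)] (f : CuspForm (Gamma0 (W.conductorNorm ℤ)) 2),
          IsNewformOf W f → ∀ (ϖ : ℚ), (ϖ : ℝ) * W.realPeriodRat = plusPeriod f →
        ∀ (L : IwasawaAlgebra p), IsSignedPAdicLFunction f p ε L →
        ∀ (D : SignedSelmerDualData W κ γ ε), Module.IsTorsion (IwasawaAlgebra p) D.X ∧
          ∃ g : IwasawaAlgebra p, D.charIdeal = Ideal.span {g} ∧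
            iwasawaToPowerSeries p g = PowerSeries.C (ϖ : ℚ_[p]) * iwasawaToPowerSeries p L :=
  Iff.rfl

/-- The signed equality contains its EISENSTEIN HALF in the shape of the Summits-side
`KobayashiLowerDivisibility` (the Néron-normalised `ϖ · L_p^ε` divides a generator of `char X^ε`:
`ι g = ϖ · ι(L · h)` with `h = 1`) — the half the rank-zero `p`-part of BSD on class X6 consumes.
Bookkeeping; nothing asserted. [cite: Kobayashi2003, Main Conj. (p. 2) and Thm. 4.1 (p. 8) (shapes only)] -/
theorem SignedCharIdealEqPadicLFunctionNeron.exists_generator_eq_mul {W : WeierstrassCurve ℚ}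
    [W.IsElliptic] [W.IsGloballyMinimal] {p : ℕ} [Fact p.Prime] {ε : ℤˣ}
    (h : SignedCharIdealEqPadicLFunctionNeron W p ε) {κ : ZpExtension ℚ p}
    {γ : Field.absoluteGaloisGroup ℚ} (hκ : κ.IsCyclotomic) (hγ : κ.IsTopGenerator γ)
    (hγ' : IsCyclotomicVariable p γ) [NeZero (W.conductorNorm ℤ)]
    {f : CuspForm (Gamma0 (W.conductorNorm ℤ)) 2} (hf : IsNewformOf W f) {ϖ : ℚ}
    (hϖ : (ϖ : ℝ) * W.realPeriodRat = plusPeriod f) {L : IwasawaAlgebra p}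
    (hL : IsSignedPAdicLFunction f p ε L) (D : SignedSelmerDualData W κ γ ε) :
    ∃ g h' : IwasawaAlgebra p, D.charIdeal = Ideal.span {g} ∧
      iwasawaToPowerSeries p g = PowerSeries.C (ϖ : ℚ_[p]) * iwasawaToPowerSeries p (L * h') := by
  obtain ⟨_, g, hg, hι⟩ := h κ γ hκ hγ hγ' f hf ϖ hϖ L hL D
  exact ⟨g, 1, hg, by rw [mul_one, hι]⟩

/-- Under the signed equality every datum has TORSION dual `X^ε(E/ℚ_∞)` (Kobayashi's Thm. 1.2 shape,
here read off the hypothesis; the tree's fact is `thm12_signedSelmerDual_finite_torsion`). Bookkeeping.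
[cite: Kobayashi2003, Thm. 1.2 (p. 2) (shape only)] -/
theorem SignedCharIdealEqPadicLFunctionNeron.isTorsion {W : WeierstrassCurve ℚ}
    [W.IsElliptic] [W.IsGloballyMinimal] {p : ℕ} [Fact p.Prime] {ε : ℤˣ}
    (h : SignedCharIdealEqPadicLFunctionNeron W p ε) {κ : ZpExtension ℚ p}
    {γ : Field.absoluteGaloisGroup ℚ} (hκ : κ.IsCyclotomic) (hγ : κ.IsTopGenerator γ)
    (hγ' : IsCyclotomicVariable p γ) [NeZero (W.conductorNorm ℤ)]
    {f : CuspForm (Gamma0 (W.conductorNorm ℤ)) 2} (hf : IsNewformOf W f) {ϖ : ℚ}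
    (hϖ : (ϖ : ℝ) * W.realPeriodRat = plusPeriod f) {L : IwasawaAlgebra p}
    (hL : IsSignedPAdicLFunction f p ε L) (D : SignedSelmerDualData W κ γ ε) :
    Module.IsTorsion (IwasawaAlgebra p) D.X :=
  (h κ γ hκ hγ hγ' f hf ϖ hϖ L hL D).1

/-- **OPEN HYPOTHESIS — UNREFEREED PREPRINT (arXiv:2409.01350v2), Prop. 11.11 (pp. 94–95), for an
elliptic curve, SUPERSINGULAR branch `a_p = 0`.** "Let `p ∤ 2N` … Suppose that `ord_{s=1} L(s,E) = 1`,
`a_p = 0`, and (van_ℚ). Let `L` be an imaginary quadratic field satisfying (ord), (coprime), (Heeg) and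
(van_L) so that `ord_{s=1} L(s, E/L) = 1`. Then Kato's main conj[.] 9.6 for `g = f_E` and the quadratic
twist `g' = g ⊗ χ_L` imply the `p`-part of the BSD conj[.] for `E`, that is, `rank_ℤ E(ℚ) = 1`,
`Ш(E)[p^∞]` is finite and `|L'(1,E)/(Ω_E R(E))|_p^{-1} = |#Ш(E)[p^∞]·∏_{ℓ∣N} c_ℓ(E)|_p^{-1}`."
Transcribed (module docstring, § supersingular branch): binders as in the ordinary twin
`prop1111_pPart_rankOne_of_mainStatements_ordinary_OPEN` with `a_p = 0` (`W.frobeniusTrace p = 0`) in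
place of `p ∤ a_p`, and the two main-conj. hypotheses as Kobayashi's signed statement 9.4 ≡ 9.6 at a
supersingular `p ∤ 2N` (Lemma 9.16 (ii)), Néron-normalised, for BOTH signs, for `W` and for the twist
`W'`: `∀ ε, SignedCharIdealEqPadicLFunctionNeron W p ε`, `∀ ε, … W' p ε` (READING FLAGS
`BSTW-1111-ss-bothsigns`, `BSTW-1111-lattice`: weaker than print, never stronger). Conclusion
`rank = 1 ∧ Ш[p^∞]` finite `∧` the no-torsion print shape at `p`. `N` arbitrary (no semistability): for
semistable `E` the tree's `thm15_pPart_OPEN` / Thm. 11.12 give the conclusion with the signed statement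
supplied by the source's Thm. 10.1. NEVER cite this `Prop` as a theorem; take it as an explicit
hypothesis. [claim: BurungaleSkinnerTianWan2024, status: under-review]
[cite: BurungaleSkinnerTianWan2024, Prop. 11.11 (pp. 94–95; label p-BSD-prop, tex l.7958) with Lemma 9.16 (ii) (p. 82) and statement 9.4 (p. 80) (ANNOUNCED, OPEN binder)] -/
def prop1111_pPart_rankOne_of_signedMainStatements_supersingular_OPEN : Prop :=
  ∀ (W W' : WeierstrassCurve ℚ) [W.IsElliptic] [W.IsGloballyMinimal] [NeZero (W.conductorNorm ℤ)]
    [W'.IsElliptic] [W'.IsGloballyMinimal] (p : ℕ) [Fact p.Prime]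
    (K : Type) [Field K] [NumberField K] (C : VariableChange ℚ),
    -- `p ∤ 2N` supersingular with `a_p = 0`, analytic rank one, (van_ℚ)
    p ≠ 2 → W.HasGoodReductionAtPrime p → W.frobeniusTrace p = 0 →
    W.analyticRank = 1 → ¬ p ∣ W.torsionOrder →
    -- `L = K`: imaginary quadratic, (ord), (coprime), (Heeg), `ord_{s=1} L(s, E/K) = 1`
    IsImaginaryQuadratic K →
    ((Ideal.span {(p : ℤ)}).primesOver (𝓞 K)).ncard = 2 →
    IsCoprime (NumberField.discr K) (W.conductorNorm ℤ) →
    SatisfiesHeegnerHypothesis (W.conductorNorm ℤ) K →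
    LDerivEK W K ≠ 0 →
    -- `E ⊗ χ_L` = the twist by `d_K`, model `W'`; (van_L)
    C • W' = W.quadraticTwist (NumberField.discr K : ℚ) → ¬ p ∣ W'.torsionOrder →
    -- Kato's main conj. 9.6 ≡ Kobayashi's signed statement 9.4 (both signs, integral, Néron
    -- normalisation) for `E` and for `E ⊗ χ_L`
    (∀ ε : ℤˣ, SignedCharIdealEqPadicLFunctionNeron W p ε) →
    (∀ ε : ℤˣ, SignedCharIdealEqPadicLFunctionNeron W' p ε) →
    -- the `p`-part of BSD for `E` in rank one
    W.mordellWeilRank = 1 ∧ Finite (AddCommGroup.primaryComponent W.sha p) ∧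
      ∃ q : ℚ, W.leadingLCoeff / ((W.realPeriodRat * W.regulator : ℝ) : ℂ) = (q : ℂ) ∧
        padicValRat p q = (padicValNat p W.shaOrder : ℤ) + padicValNat p W.tamagawaProduct

variable (W W' : WeierstrassCurve ℚ) [W.IsElliptic] [W.IsGloballyMinimal] [NeZero (W.conductorNorm ℤ)]
  [W'.IsElliptic] [W'.IsGloballyMinimal] (p : ℕ) [Fact p.Prime]
  {K : Type} [Field K] [NumberField K] {C : VariableChange ℚ}

/-- **Granted the OPEN binder (supersingular branch), the signed statements for `E` and `E^{(d_K)}`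
give the general print shape `PPart W p` in rank one** (the torsion term vanishes under (van_ℚ)).
CONDITIONAL; closes nothing. [claim: BurungaleSkinnerTianWan2024, status: under-review]
[cite: BurungaleSkinnerTianWan2024, Prop. 11.11 (pp. 94–95; OPEN binder)] [cite: YanZhu2026, Thm. 4.15 (display; shape of `PPart`)] -/
theorem pPart_of_prop1111_supersingular_OPEN
    (hBSTW_OPEN : prop1111_pPart_rankOne_of_signedMainStatements_supersingular_OPEN)
    (hp2 : p ≠ 2) (hgood : W.HasGoodReductionAtPrime p) (hap : W.frobeniusTrace p = 0)
    (hr : W.analyticRank = 1) (hvan : ¬ p ∣ W.torsionOrder) (hK : IsImaginaryQuadratic K)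
    (hsplit : ((Ideal.span {(p : ℤ)}).primesOver (𝓞 K)).ncard = 2)
    (hcop : IsCoprime (NumberField.discr K) (W.conductorNorm ℤ))
    (hH : SatisfiesHeegnerHypothesis (W.conductorNorm ℤ) K) (hL : LDerivEK W K ≠ 0)
    (hC : C • W' = W.quadraticTwist (NumberField.discr K : ℚ)) (hvan' : ¬ p ∣ W'.torsionOrder)
    (hMC : ∀ ε : ℤˣ, SignedCharIdealEqPadicLFunctionNeron W p ε)
    (hMC' : ∀ ε : ℤˣ, SignedCharIdealEqPadicLFunctionNeron W' p ε) :
    W.mordellWeilRank = 1 ∧ Finite (AddCommGroup.primaryComponent W.sha p) ∧ PPart W p := by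
  obtain ⟨hrank, hfin, q, hq, hv⟩ :=
    hBSTW_OPEN W W' p K C hp2 hgood hap hr hvan hK hsplit hcop hH hL hC hvan' hMC hMC'
  refine ⟨hrank, hfin, q, hq, ?_⟩
  rw [hv, padicValNat.eq_zero_of_not_dvd hvan]
  push_cast
  ring

/-- **Granted the OPEN binder (supersingular branch): Miller's `BSD(E,p)` in analytic rank one from
Kobayashi's signed statements for `E` and `E^{(d_K)}`** — via `bsdp_of_pPart` (modularity `hmod`,
Gross–Zagier–Kolyvagin `hGZK`, PUBLISHED facts by name). HEIGHT-FREE (no `p`-adic Gross–Zagier of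
Kobayashi 2013, no (sur)), for a curve of ARBITRARY conductor at a good supersingular `p > 2` with
`a_p = 0`: the supersingular twin of `bsdp_of_prop1111_OPEN`. CONDITIONAL on the PRE binder; closes
nothing; no class is booked. [claim: BurungaleSkinnerTianWan2024, status: under-review]
[cite: BurungaleSkinnerTianWan2024, Prop. 11.11 (pp. 94–95; OPEN binder)] [cite: Miller2011LMS, §1 and Def. 1.1] -/
theorem bsdp_of_prop1111_supersingular_OPEN
    (hBSTW_OPEN : prop1111_pPart_rankOne_of_signedMainStatements_supersingular_OPEN)
    (hmod : hasEntireLFunction_rat) (hGZK : rank_eq_analyticRank_of_analyticRank_le_one)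
    (hp2 : p ≠ 2) (hgood : W.HasGoodReductionAtPrime p) (hap : W.frobeniusTrace p = 0)
    (hr : W.analyticRank = 1) (hvan : ¬ p ∣ W.torsionOrder) (hK : IsImaginaryQuadratic K)
    (hsplit : ((Ideal.span {(p : ℤ)}).primesOver (𝓞 K)).ncard = 2)
    (hcop : IsCoprime (NumberField.discr K) (W.conductorNorm ℤ))
    (hH : SatisfiesHeegnerHypothesis (W.conductorNorm ℤ) K) (hL : LDerivEK W K ≠ 0)
    (hC : C • W' = W.quadraticTwist (NumberField.discr K : ℚ)) (hvan' : ¬ p ∣ W'.torsionOrder)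
    (hMC : ∀ ε : ℤˣ, SignedCharIdealEqPadicLFunctionNeron W p ε)
    (hMC' : ∀ ε : ℤˣ, SignedCharIdealEqPadicLFunctionNeron W' p ε) :
    BSDp W p :=
  bsdp_of_pPart W p hmod hGZK hr.le
    (pPart_of_prop1111_supersingular_OPEN W W' p hBSTW_OPEN hp2 hgood hap hr hvan hK hsplit hcop
      hH hL hC hvan' hMC hMC').2.2

end Literature.NumberTheory.EllipticCurves.BurungaleSkinnerTianWan2024

end
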